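import Summits.ResolutionOfSingularities.ResolutionOfSingularities.Theorems.WeightedInvariantIota3IsoSuccNoStatCurve
import Summits.ResolutionOfSingularities.ResolutionOfSingularities.Theorems.WeightedInvariantIota3CurveFracTieZeroSigmaReduction
import Summits.ResolutionOfSingularities.ResolutionOfSingularities.Theorems.WeightedInvariantIotaOrderOffExceptional
import Summits.ResolutionOfSingularities.ResolutionOfSingularities.Theorems.WeightedInvariantIota3EpsStratumRing
import HarnessLib

/-!
# (iso-succ) PART C, position corollary: at an ISOLATED σ-maximal start every order-stationary `t`-homogeneous successor is again an
# ISOLATED position — `ε` does not rise (door `HypersurfaceCentreConstruction`, stmt-ResolutionOfSingularities-19897; stub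
# `stub_keyRungGrHomLE_three`, residual (D-b³-point-STAT) of …KeyRungThreeOfDropPointStat, ISOLATED regime)

Topic: `Summits/ResolutionOfSingularities/ResolutionOfSingularities/Theorems`.  DEF-FREE.  Helper `--supports stmt-ResolutionOfSingularities-19897`.

Hand -11's question to the disprover (…KeyRungThreeOfDropPointStat, NONREACH-K.md §4): can an order-stationary `t`-homogeneous successor of an
ISOLATED start have `ε = 1` (equimultiple locus = a curve or two crossing curves through the successor), which would RAISE `ι₀ = (ν ; ε ; τ)` and
refute (D-b³-point-STAT) as typed?  ANSWER (at σ-maximal presentations, i.e. at the centre `J₃ᵗ = jSigmaPt` of record): NO.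

* `Iota3.iotaOrd_lt_of_lt_of_isSigmaMaximiser` — `S` regular local of Krull dimension `3`, `(g₁, g₂; q, r₁, r₂)` a σ-maximiser of `f` at order
  `ν ≥ 1`, `f ∈ 𝔪^ν ∖ 𝔪^{ν+1}`, `(x, g₂, g₁) = 𝔪`, and the start ISOLATED in the order letter (`ord_{S_𝔮₀} f < ν` at every prime `𝔮₀ ≠ 𝔪`); `I`
  ANY filtration equal to `𝒥((x, g₂, g₁); (q, r₂, r₁))` (carrier transport by `subst`), `B = S[t⁻¹, Iₙtⁿ]`.  Then at every prime `𝔮` STRICTLY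
  BELOW a `t`-homogeneous off-vertex prime `𝔫₁ ∋ t⁻¹` and every factorisation `f = (t⁻¹)ᵃ g`, `t⁻¹ ∤ g`: `ord_{B_𝔮}(g/1) < ν`.
  (`t⁻¹ ∈ 𝔮`: PART C …IsoSuccNoStatCurve; `t⁻¹ ∉ 𝔮`: the order is the order downstairs at `𝔮 ∩ S ≠ 𝔪` — …IotaOrderOffExceptional — since a
  prime over `𝔪` missing `t⁻¹` contains every `uᵢ t^{wᵢ}`, i.e. the vertex.)
* **`Iota3.isIsolatedPosition_transform_of_isSigmaMaximiser`** — hence, if the transform is ORDER-STATIONARY at `𝔫₁` (`g/1 ∈ 𝔪_{𝔫₁}^ν`), the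
  position `(B_{𝔫₁}, g/1)` is ISOLATED (`topStratum iotaOrd = {𝔪}`, res-type-078's `topStratum_iotaOrd_eq_setOf_map_le`); at the regular local
  ring `B_{𝔫₁}` (of dimension `≤ 3`) this gives `ε(B_{𝔫₁}, g/1) = 0` (`iotaEps_eq_zero_of_isIsolatedPosition`), `τ = 0` and the `σ`-cylinder read
  pointwise (…CurveFracTieZeroSigmaReduction `iotaOrdEpsTau_eq_of_isIsolatedPosition` / `iotaCylinder_eq_iotaSigma_of_isIsolated`).

So in the ISOLATED regime (D-b³-point-STAT) is EXACTLY the pointwise `σ`-comparison `σ(B_{𝔫₁}, g/1) < σ(S, f)` at the isolated order-stationary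
orbit-points `𝔫₁` of the weighted exceptional plane (next hand: the transport to every presentation `(u, w)` of `J₃ᵗ` through the tree's canonical
σ-presentation — `sigmaMaximiserExistsLE3_of_atLevel`, `jSigmaCanonicalLE3_of_atLevel`, `jFlatT_eq_weightedMonomialIdeal_of_canonicalAt` — and the
gap-list rewrite of `keyRungGrHomLE_three_of_tieDescent_pointStat`).

[OURS · L1 W4.3 · AI work, weaker than expert review; nothing here is a statement of the manuscript under review (Hironaka 2017,
[claim: Hironaka2017, status: under-review]).]

## References

* D. Abramovich, M. Temkin, J. Włodarczyk, *Functorial embedded resolution via weighted blowings up*, Algebra & Number Theory 18 (2024), §5. [AbramovichTemkinWlodarczyk2024]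
* J. Włodarczyk, *Functorial resolution by torus actions*, arXiv:2203.03090, Def. 2.3.5, §3.3. [Wlodarczyk2022]
-/

noncomputable section

open IsLocalRing Literature.AlgebraicGeometry.Resolution
open Summit.ResolutionOfSingularities.ResolutionOfSingularities.Theorems
open Summit.ResolutionOfSingularities.ResolutionOfSingularities.Theorems.ContactCylinder

set_option linter.dupNamespace false -- mandated namespace of this single-conjunct summit

namespace Summit.ResolutionOfSingularities.ResolutionOfSingularities.Cruxes.HypersurfaceCentreConstruction.LocalEngine

namespace Iota3

/-- **The order drops at EVERY prime strictly below a `t`-homogeneous successor of an ISOLATED σ-maximal start** (carrier-transported form: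
`I` any filtration equal to the σ-flag filtration; `t`-homogeneity spelled out on `extReesAlgebra I`). [OURS · L1 W4.3 · (iso-succ) PART C]
[cite: Wlodarczyk2022, Def. 2.3.5] -/
theorem iotaOrd_lt_of_lt_of_isSigmaMaximiser {S : Type} [CommRing S] [IsRegularLocalRing S] (hdim : ringKrullDim S = 3)
    {f x g₁ g₂ : S} {ν q r₁ r₂ : ℕ} (hν : 0 < ν) (hmax : IsSigmaMaximiser f ν g₁ g₂ q r₁ r₂)
    (hfν1 : f ∉ maximalIdeal S ^ (ν + 1)) (hx : Ideal.span {x, g₂, g₁} = maximalIdeal S)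
    (hiso : ∀ (𝔮₀ : Ideal S) [𝔮₀.IsPrime], 𝔮₀ ≠ maximalIdeal S →
      iotaOrd (Localization.AtPrime 𝔮₀) (algebraMap S (Localization.AtPrime 𝔮₀) f) < ν)
    {I : ℕ → Ideal S} (hI : I = weightedMonomialIdeal ![x, g₂, g₁] ![q, r₂, r₁]) :
    ∀ (𝔫₁ : Ideal (extReesAlgebra I)) [𝔫₁.IsPrime], extReesAlgebra.tInv I ∈ 𝔫₁ →
      Ideal.span {b | b ∈ 𝔫₁ ∧ SetLike.IsHomogeneousElem (KWildHom.tPiece (extReesAlgebra I)) b} = 𝔫₁ →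
      ¬ (extReesAlgebra.vertexIdeal I ≤ 𝔫₁) →
      ∀ (a' : ℕ) (g : extReesAlgebra I), algebraMap S (extReesAlgebra I) f = extReesAlgebra.tInv I ^ a' * g →
        ¬ (extReesAlgebra.tInv I ∣ g) →
        ∀ (𝔮 : Ideal (extReesAlgebra I)) [𝔮.IsPrime], 𝔮 < 𝔫₁ →
          iotaOrd (Localization.AtPrime 𝔮) (algebraMap (extReesAlgebra I) (Localization.AtPrime 𝔮) g) < ν := by
  subst hI
  intro 𝔫₁ _ hT₁ hhom hV a' g hfg hndvd 𝔮 _ hlt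
  by_cases hT : extReesAlgebra.tInv (weightedMonomialIdeal ![x, g₂, g₁] ![q, r₂, r₁]) ∈ 𝔮
  · -- on the exceptional divisor: PART C
    exact iotaOrd_lt_below_of_isSigmaMaximiser hdim hν hmax hfν1 hx 𝔮 hT 𝔫₁ hlt hhom hV a' g hfg hndvd
  · -- off the exceptional divisor: the order downstairs at `𝔮 ∩ S ≠ 𝔪`
    haveI : (𝔮.comap (algebraMap S (extReesAlgebra (weightedMonomialIdeal ![x, g₂, g₁] ![q, r₂, r₁])))).IsPrime :=
      Ideal.IsPrime.comap _
    have hne : 𝔮.comap (algebraMap S (extReesAlgebra (weightedMonomialIdeal ![x, g₂, g₁] ![q, r₂, r₁]))) ≠ maximalIdeal S := by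
      intro heq
      apply hV
      refine (LocalGameEFTPointMove.vertexIdeal_le_span_range_uT ![x, g₂, g₁] ![q, r₂, r₁]).trans
        ((Ideal.span_le.mpr ?_).trans hlt.le)
      rintro _ ⟨i, rfl⟩
      have hui : (![x, g₂, g₁] : Fin 3 → S) i ∈ maximalIdeal S := by
        rw [← hx]
        fin_cases i
        · exact Ideal.subset_span (by simp)
        · exact Ideal.subset_span (by simp)
        · exact Ideal.subset_span (by simp)
      rw [← heq, Ideal.mem_comap, LocalGameEFTPointMove.algebraMap_u_eq] at hui
      rcases Ideal.IsPrime.mem_or_mem ‹𝔮.IsPrime› hui with h | h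
      · exact absurd (Ideal.IsPrime.mem_of_pow_mem ‹𝔮.IsPrime› _ h) hT
      · exact h
    have hunit : IsUnit (algebraMap _ (Localization.AtPrime 𝔮) (extReesAlgebra.tInv (weightedMonomialIdeal ![x, g₂, g₁] ![q, r₂, r₁]))) :=
      IsLocalization.map_units (Localization.AtPrime 𝔮) (⟨_, hT⟩ : 𝔮.primeCompl)
    have h1 : iotaOrd (Localization.AtPrime 𝔮) (algebraMap _ (Localization.AtPrime 𝔮)
        (algebraMap S (extReesAlgebra (weightedMonomialIdeal ![x, g₂, g₁] ![q, r₂, r₁])) f)) =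
        iotaOrd (Localization.AtPrime 𝔮) (algebraMap _ (Localization.AtPrime 𝔮) g) := by
      rw [hfg, map_mul, map_pow]
      exact iotaOrd_unitInvariant _ _ _ (hunit.pow a')
    rw [← h1, iotaOrd_extRees_atPrime_eq_of_tInv_not_mem _ 𝔮 hT f]
    exact hiso _ hne

/-- **ORDER-STATIONARY successors of an ISOLATED σ-maximal start are ISOLATED positions** (`topStratum iotaOrd (B_{𝔫₁}) (g/1) = {𝔪}`).
[OURS · L1 W4.3 · (iso-succ) PART C, position corollary] [cite: AbramovichTemkinWlodarczyk2024, §5] -/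
theorem isIsolatedPosition_transform_of_isSigmaMaximiser {S : Type} [CommRing S] [IsRegularLocalRing S] (hdim : ringKrullDim S = 3)
    {f x g₁ g₂ : S} {ν q r₁ r₂ : ℕ} (hν : 0 < ν) (hmax : IsSigmaMaximiser f ν g₁ g₂ q r₁ r₂)
    (hfν1 : f ∉ maximalIdeal S ^ (ν + 1)) (hx : Ideal.span {x, g₂, g₁} = maximalIdeal S)
    (hiso : ∀ (𝔮₀ : Ideal S) [𝔮₀.IsPrime], 𝔮₀ ≠ maximalIdeal S →
      iotaOrd (Localization.AtPrime 𝔮₀) (algebraMap S (Localization.AtPrime 𝔮₀) f) < ν)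
    {I : ℕ → Ideal S} (hI : I = weightedMonomialIdeal ![x, g₂, g₁] ![q, r₂, r₁]) :
    ∀ (𝔫₁ : Ideal (extReesAlgebra I)) [𝔫₁.IsPrime], extReesAlgebra.tInv I ∈ 𝔫₁ →
      Ideal.span {b | b ∈ 𝔫₁ ∧ SetLike.IsHomogeneousElem (KWildHom.tPiece (extReesAlgebra I)) b} = 𝔫₁ →
      ¬ (extReesAlgebra.vertexIdeal I ≤ 𝔫₁) →
      ∀ (a' : ℕ) (g : extReesAlgebra I), algebraMap S (extReesAlgebra I) f = extReesAlgebra.tInv I ^ a' * g →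
        ¬ (extReesAlgebra.tInv I ∣ g) →
        algebraMap (extReesAlgebra I) (Localization.AtPrime 𝔫₁) g ∈ maximalIdeal (Localization.AtPrime 𝔫₁) ^ ν →
        IsIsolatedPosition (Localization.AtPrime 𝔫₁) (algebraMap (extReesAlgebra I) (Localization.AtPrime 𝔫₁) g) := by
  intro 𝔫₁ _ hT₁ hhom hV a' g hfg hndvd hgν
  have hbelow := iotaOrd_lt_of_lt_of_isSigmaMaximiser hdim hν hmax hfν1 hx hiso hI 𝔫₁ hT₁ hhom hV a' g hfg hndvd
  have hν₁ : (ν : Ordinal.{0}) ≤ iotaOrd (Localization.AtPrime 𝔫₁) (algebraMap (extReesAlgebra I) (Localization.AtPrime 𝔫₁) g) :=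
    (natCast_le_iotaOrd_iff _ _ ν).mpr hgν
  unfold IsIsolatedPosition
  rw [topStratum_iotaOrd_eq_setOf_map_le 𝔫₁ (Localization.AtPrime 𝔫₁) g 𝔫₁ ?_, Localization.AtPrime.map_eq_maximalIdeal]
  intro 𝔮 _ hle
  constructor
  · intro h
    exact iotaOrd_atPrime_congr (le_antisymm hle h) g
  · intro h
    by_contra hnle
    have hlt : 𝔮 < 𝔫₁ := lt_of_le_of_ne hle fun e => hnle e.ge
    have h' := hbelow 𝔮 hlt
    rw [h] at h'
    exact absurd (lt_of_le_of_lt hν₁ h') (lt_irrefl _)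

end Iota3

end Summit.ResolutionOfSingularities.ResolutionOfSingularities.Cruxes.HypersurfaceCentreConstruction.LocalEngine

end
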